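import Mathlib
import HarnessLib
import Summits.HubbardSuperconductivity.HubbardSuperconductivity.Theorems.KLProgrammeH10TwoPointLimitPerturbedAnchoredSectorCountThin
import Summits.HubbardSuperconductivity.HubbardSuperconductivity.Theorems.KLProgrammeH10TwoPointLimitFrameSectorCount

/-!
# Route `KLProgramme` — K3 engine child `KLRegimeEngineV17F2` (stmt-HubbardSuperconductivity-20437), stub (b) import ι₂:
# the ANCHORED THIN four-sector count ON ADMISSIBLE FRAMES (every `C₄ᵥ` frame of small `C²` size; every `FrameOK` frame in the KL regime)

Cell gate-hubbard-kl, plan g17 (R41)(i) «E1-P2-THIN-COUNT» (seat p4; file 5, frame layer).  `anchoredSectorCount_thin_perturbed` (thin shells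
`c_T·w²` around the moving curve `{ε₀ + δ = μ}`, anchor sector prescribed, `≤ K·2ⁿ`) at `δ := frameShift K ∘ toLp` for a frame `K : TrigPolyC4v`
(dictionary of `…FramePerturbation`: smooth, even, periodic, `|δ_K|, ‖Dδ_K‖, ‖D²δ_K‖ ≤ A, 2A, 4A`), then in the KL regime through `FrameOK R U (nScales β) ν K`
(`norm_iteratedFDeriv_frameShift_le_of_frameOK_regime`, `frame_thresholds`): the shells are the frame shells `|frameLevel μ K| ≤ c_T·(π/2ⁿ)²` — at
`c_T = e₀/π²` exactly the support shells `|e_K| < e₀4^{-n}` of the anisotropic multipliers `klAnisoFamily … n` (`support_klAnisoFamily`).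

* **`anchoredSectorCount_thin_frame`**, **`anchoredSectorCount_thin_frameOK`**.

Everything is PROVED; no definitions.  References: BGM 2006 Lemma 3.1 / (2.76) / (2.80) / App. A3 [cite: BenfattoGiulianiMastropietro2006];
Mastropietro 2008 (14.67) p. 223 [cite: Mastropietro2008].
-/

noncomputable section

namespace Summit.HubbardSuperconductivity.HubbardSuperconductivity.Theorems.PerturbedFermiCurve

set_option linter.dupNamespace false -- summit = problem name (single-conjunct summit), D-0017

open Classical
open Real Set Finset
open Literature.MathematicalPhysics.QuantumLattice Literature.MathematicalPhysics.QuantumLattice.BandSectorCounting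
open Summit.HubbardSuperconductivity.HubbardSuperconductivity.Theorems.DispersionFlow
open Summit.HubbardSuperconductivity.HubbardSuperconductivity.Theorems.KLRegimeSplit

/-- **The anchored thin four-sector count ON THE CURVE OF A FRAME.**  For every level window `[μ₁, μ₂] ⊂ (-4, 0)` and thickness constant `c_T ≥ 0`
there are `κ > 0` and `K` such that for EVERY frame `K : TrigPolyC4v` with `C²` size `A`, `4A ≤ κ`, every `μ ∈ [μ₁, μ₂]`, every scale `n`,
reciprocal vector `2πG` and anchor sector `ω₁`: the number of sector triples `(ω₂, ω₃, ω₄)` of angular width `π/2ⁿ` admitting momenta of the THIN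
frame shells `|frameLevel μ K| ≤ c_T (π/2ⁿ)²` in the prescribed sectors (anchor included) with `k₁ + k₂ + k₃ + k₄ = 2πG` is `≤ K·2ⁿ`.
[cite: BenfattoGiulianiMastropietro2006, Lemma 3.1 / (2.76) / (2.80) / App. A3] -/
theorem anchoredSectorCount_thin_frame :
    ∀ μ₁ μ₂ cT : ℝ, -4 < μ₁ → μ₁ ≤ μ₂ → μ₂ < 0 → 0 ≤ cT → ∃ κ : ℝ, 0 < κ ∧ ∃ K : ℝ, 0 < K ∧
      ∀ (K' : TrigPolyC4v) (A : ℝ), (∀ p : Momentum, ∀ j ≤ 2, ‖iteratedFDeriv ℝ j (frameShift K') p‖ ≤ A) → 4 * A ≤ κ →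
      ∀ μ ∈ Set.Icc μ₁ μ₂, ∀ (n : ℕ) (G : Fin 2 → ℤ) (ω₁ : Fin (sectorCount n)),
      (((Finset.univ : Finset (Fin (sectorCount n) × Fin (sectorCount n) × Fin (sectorCount n))).filter
        (fun ω : Fin (sectorCount n) × Fin (sectorCount n) × Fin (sectorCount n) =>
        ∃ k : Fin 4 → Fin 2 → ℝ, (∀ j i, |k j i| ≤ Real.pi) ∧ (∀ j, |frameLevel μ K' (WithLp.toLp 2 (k j))| ≤ cT * sectorWidth n ^ 2) ∧
          sectorIndex n (Complex.arg (⟨k 0 0, k 0 1⟩ : ℂ)) = (ω₁ : ℕ) ∧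
          sectorIndex n (Complex.arg (⟨k 1 0, k 1 1⟩ : ℂ)) = (ω.1 : ℕ) ∧
          sectorIndex n (Complex.arg (⟨k 2 0, k 2 1⟩ : ℂ)) = (ω.2.1 : ℕ) ∧
          sectorIndex n (Complex.arg (⟨k 3 0, k 3 1⟩ : ℂ)) = (ω.2.2 : ℕ) ∧
          (∀ i, ∑ j, k j i = 2 * Real.pi * (G i : ℝ)))).card : ℝ) ≤ K * 2 ^ n := by
  intro μ₁ μ₂ cT hμ₁ h12 hμ₂ hc
  obtain ⟨κ, hκ, Kc, hKc, h⟩ := anchoredSectorCount_thin_perturbed μ₁ μ₂ cT hμ₁ h12 hμ₂ hc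
  -- a margin so that a root selection of the frame's curve exists
  have ha : -4 < (μ₁ - 4) / 2 := by linarith
  have hab : (μ₁ - 4) / 2 ≤ μ₂ / 2 := by linarith
  have hb : μ₂ / 2 < 0 := by linarith
  set m₀ := min (μ₁ - (μ₁ - 4) / 2) (μ₂ / 2 - μ₂) with hm₀def
  have hm₀ : 0 < m₀ := lt_min (by linarith) (by linarith)
  have hm1 : m₀ ≤ μ₁ - (μ₁ - 4) / 2 := min_le_left _ _; have hm2 : m₀ ≤ μ₂ / 2 - μ₂ := min_le_right _ _
  refine ⟨min κ m₀, lt_min hκ hm₀, Kc, hKc, ?_⟩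
  intro K' A hA hAκ μ hμ n G ω₁
  have hA4 : 4 * A ≤ κ := hAκ.trans (min_le_left _ _)
  have hAm : 4 * A ≤ m₀ := hAκ.trans (min_le_right _ _)
  have hA0 : 0 ≤ A := le_trans (norm_nonneg _) (hA 0 0 (by norm_num))
  obtain ⟨hδ, hκ₁, hκ₂⟩ := frameShift_toLp_small hA hA4
  set δ : (Fin 2 → ℝ) → ℝ := fun k => frameShift K' (WithLp.toLp 2 k) with hδdef
  have hδsq : ∀ k : Fin 2 → ℝ, (∀ i, |k i| ≤ π) → |δ k| ≤ A := fun k _ => abs_frameShift_toLp_le hA k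
  have hlo : (μ₁ - 4) / 2 ≤ μ - A := by linarith [hμ.1]
  have hhi : μ + A ≤ μ₂ / 2 := by linarith [hμ.2]
  have hu := isBandFermiRadius_perturbedFermiRadius (bandBounds ha hab hb) (continuous_frameShift_toLp K') hδsq hlo hhi
  have hmain := h δ (contDiff_frameShift_toLp K' (m := 2)) (frameShift_toLp_neg K') (frameShift_toLp_periodic K') hδ hκ₁ hκ₂ μ hμ
    (perturbedFermiRadius δ μ) hu n G ω₁
  have hfilt : ∀ ω : Fin (sectorCount n) × Fin (sectorCount n) × Fin (sectorCount n),
      (∃ k : Fin 4 → Fin 2 → ℝ, (∀ j i, |k j i| ≤ Real.pi) ∧ (∀ j, |frameLevel μ K' (WithLp.toLp 2 (k j))| ≤ cT * sectorWidth n ^ 2) ∧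
          sectorIndex n (Complex.arg (⟨k 0 0, k 0 1⟩ : ℂ)) = (ω₁ : ℕ) ∧
          sectorIndex n (Complex.arg (⟨k 1 0, k 1 1⟩ : ℂ)) = (ω.1 : ℕ) ∧
          sectorIndex n (Complex.arg (⟨k 2 0, k 2 1⟩ : ℂ)) = (ω.2.1 : ℕ) ∧
          sectorIndex n (Complex.arg (⟨k 3 0, k 3 1⟩ : ℂ)) = (ω.2.2 : ℕ) ∧
          (∀ i, ∑ j, k j i = 2 * Real.pi * (G i : ℝ))) ↔
      (∃ k : Fin 4 → Fin 2 → ℝ, (∀ j i, |k j i| ≤ Real.pi) ∧ (∀ j, |sqDispersion (k j) + δ (k j) - μ| ≤ cT * sectorWidth n ^ 2) ∧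
          sectorIndex n (Complex.arg (⟨k 0 0, k 0 1⟩ : ℂ)) = (ω₁ : ℕ) ∧
          sectorIndex n (Complex.arg (⟨k 1 0, k 1 1⟩ : ℂ)) = (ω.1 : ℕ) ∧
          sectorIndex n (Complex.arg (⟨k 2 0, k 2 1⟩ : ℂ)) = (ω.2.1 : ℕ) ∧
          sectorIndex n (Complex.arg (⟨k 3 0, k 3 1⟩ : ℂ)) = (ω.2.2 : ℕ) ∧
          (∀ i, ∑ j, k j i = 2 * Real.pi * (G i : ℝ))) := by
    intro ω
    simp only [frameLevel_toLp, hδdef]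
  rw [Finset.filter_congr fun ω _ => hfilt ω]
  exact hmain

/-- **The anchored thin four-sector count ON EVERY ADMISSIBLE FRAME IN THE KL REGIME**: for the window and `c_T` there is `K` (fixed BEFORE the
renormalisation constants `R`), and for every `R` thresholds `c₃, U₀ > 0`, such that for every `0 < c ≤ c₃`, `0 < U ≤ U₀`,
`klBetaMin ≤ β ≤ e^{c/U²}`, `μ ∈ [μ₁, μ₂]`, every frame with `FrameOK R U (nScales β) ν K`, and every `n, G, ω₁`, the anchored thin count is
`≤ K·2ⁿ` — `K` uniform in the frame, `β`, `U`, `c`, the anchor.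
[cite: BenfattoGiulianiMastropietro2006, Lemma 3.1 / (2.76) / (2.80) / App. A3] -/
theorem anchoredSectorCount_thin_frameOK :
    ∀ μ₁ μ₂ cT : ℝ, -4 < μ₁ → μ₁ ≤ μ₂ → μ₂ < 0 → 0 ≤ cT → ∃ K : ℝ, 0 < K ∧ ∀ R : RenConsts, (∀ j, 0 ≤ R.Gfr j) →
      ∃ c₃ : ℝ, 0 < c₃ ∧ ∃ U₀ : ℝ, 0 < U₀ ∧
      ∀ c : ℝ, 0 < c → c ≤ c₃ → ∀ U : ℝ, 0 < U → U ≤ U₀ → ∀ β : ℝ, klBetaMin ≤ β → β ≤ Real.exp (c / U ^ 2) →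
      ∀ μ ∈ Set.Icc μ₁ μ₂, ∀ (ν : ℝ) (K' : TrigPolyC4v), FrameOK R U (nScales β) ν K' →
      ∀ (n : ℕ) (G : Fin 2 → ℤ) (ω₁ : Fin (sectorCount n)),
      (((Finset.univ : Finset (Fin (sectorCount n) × Fin (sectorCount n) × Fin (sectorCount n))).filter
        (fun ω : Fin (sectorCount n) × Fin (sectorCount n) × Fin (sectorCount n) =>
        ∃ k : Fin 4 → Fin 2 → ℝ, (∀ j i, |k j i| ≤ Real.pi) ∧ (∀ j, |frameLevel μ K' (WithLp.toLp 2 (k j))| ≤ cT * sectorWidth n ^ 2) ∧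
          sectorIndex n (Complex.arg (⟨k 0 0, k 0 1⟩ : ℂ)) = (ω₁ : ℕ) ∧
          sectorIndex n (Complex.arg (⟨k 1 0, k 1 1⟩ : ℂ)) = (ω.1 : ℕ) ∧
          sectorIndex n (Complex.arg (⟨k 2 0, k 2 1⟩ : ℂ)) = (ω.2.1 : ℕ) ∧
          sectorIndex n (Complex.arg (⟨k 3 0, k 3 1⟩ : ℂ)) = (ω.2.2 : ℕ) ∧
          (∀ i, ∑ j, k j i = 2 * Real.pi * (G i : ℝ)))).card : ℝ) ≤ K * 2 ^ n := by
  intro μ₁ μ₂ cT hμ₁ h12 hμ₂ hcT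
  obtain ⟨κ, hκ, Kc, hKc, h⟩ := anchoredSectorCount_thin_frame μ₁ μ₂ cT hμ₁ h12 hμ₂ hcT
  refine ⟨Kc, hKc, fun R hR => ?_⟩
  obtain ⟨c₃, hc₃, U₀, hU₀, hthr⟩ := frame_thresholds hR hκ
  refine ⟨c₃, hc₃, U₀, hU₀, ?_⟩
  intro c hc hcle U hU hUle β hβmin hβc μ hμ ν K' hK' n G ω₁
  exact h K' _ (fun p j hj => norm_iteratedFDeriv_frameShift_le_of_frameOK_regime hR hc.le hβmin hβc hK' p hj)
    (hthr c U hc.le hcle hU hUle) μ hμ n G ω₁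

end Summit.HubbardSuperconductivity.HubbardSuperconductivity.Theorems.PerturbedFermiCurve

end
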